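import Summits.QuantumFields.BalabanUV.Beta.GAN24.CombHalfMemberSlavedDivergence

/-!
# `BalabanUV.Beta.GAN24.CombHalfMemberSlavedDivergenceLaws` — binder row G-an2-4 ∕ (CONV-C), TRANSFER-III (the (α-0) chain at row D1's literal of record (III′)),
# link L8b, PART 2 of `CombHalfMemberSlavedDivergence`: **SLAVE-src FOR THE `ε`-MEMBER OF THE COMB-CHART `T₂` TOWER — THE COMPOSITION OF PART 1's T-EQ WITH MY (E)
# PARITY-SPLIT SLAVING UNDER THE TWO RAW TABLE LAWS (LETTERS), AND THE TWO NAMED MEMBERS: EVEN (`ε = 1`, NO remainder `R`) and ODD (`ε = −1`, NO commutator)**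
# — MY lineage's (E) file `HalfMemberSlavedDivergenceComb` (gen 72) RE-RUN at the sym ∕ comb slot data `(GcombSh Lc ·, SpureCombOf tabs, tabs.M, tabs.vh₂S, tabs.mixFF)`
# (G-an2-4 CRUX TEAM (2), leaf prover `b2b-balaban-gan24-formalise-leaf-01`, gen 80; the OWNER gan24-p1 g46's (III′) link table R-gan24p1-g46-2, row «L8b–L9»; no existing file touched)

NOT IN PRINT; OUR BOOKKEEPING ([folklore] composition BY NAME; statements = the (E) file's with `(coDressKBmAt ρ Lc (KInvStep Lc ·), T2RecAt ρ, SpureRecAt ρ, M1At ρ cΛ, vh₂S,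
mixFFAt ρ Lc) ↦ (GcombSh Lc ·, T2RecOf … (GcombSh Lc) (SpureCombOf tabs …) tabs.M …, SpureCombOf tabs, tabs.M, tabs.vh₂S, tabs.mixFF)`, root binders `hLc hr` and the border class
`hB` ↦ the record `tabs`; proofs token for token; 0 `def`, 0 cited facts, 0 `def … : Prop`, 0 sorry).  HONEST FRAMING (cell contract, verbatim): «discharging `BetaPertH`
makes Bałaban's UV stability UNCONDITIONAL — a real constructive-QFT result; it is NOT the continuum limit and NOT the Clay problem.»  HONEST DEPENDENCY (verbatim):
«continuum YM on T⁴ ⇐ BetaPertH ∧ nine spine estimates (0/9 proved); BetaPertH ⇐ (D1) ∧ (D4) ∧ CAP+tail; G-an2-4 gates asym, D1 and NE2/3/4.»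

WHAT (objects as in PART 1 and the OWNER's T5 §1: `T̃′_j := T2RecOf d Lc (GcombSh Lc) (SpureCombOf tabs cE cVH cΛ) tabs.M cE₂ cB Tc tabs.vh₂S tabs.mixFF j`, `T̃′♮_j := unitS₂_j T̃′_j`,
`G′♮_j := unitK_j (GcombSh Lc j)`, `c₄ := cE₂·Lc^{2(d+1)}`, the dressed source `b̃′♮_j`, `P := sgnK ∘ trK` slotwise, `y_j := ½ • (T̃′♮_j + ε • P T̃′♮_j)`; any record `tabs : SymTables d Lc`
with off-diagonal border `hBff hBmm`; generic `d`, `Lc ≥ 1` via `[NeZero Lc]`):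
* §2 **`divW_halfMember_comb_succ_eq_slaved`** (letters `S X R R″ cH′`, `cH′ ≠ 0`; the two RAW table laws `hTL ∕ hTL″` of `T̃′_j` in the literal conclusion shape of an2's
  slot-generic `WardLocusQuarticTableSlot.tableLaw_T2RecOf_succ ∕ '' ∕ _zero ∕ ''` at `G := GcombSh Lc` — verbatim MY (E) PART 2 letters —, the commutator word parity-EVEN
  `hC`, the remainders parity-ODD `hR hR″`): `divW (y_{j+1}) y ν y′ = divW (½ • (b̃′♮_j + ε • P b̃′♮_j)) y ν y′ + (c₄·(Lc^{d+1})⁻¹∕2) • (e3OfK Lc G′♮_j [(sf_j·sm_j)⁻¹ •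
  unitS_j (cH′⁻¹ • (((1+ε)∕2) • (S ∘ X_y − X_y ∘ S) + ((1−ε)∕2) • R y))] ν y′ + the ″ twin)` (PART 1 §1 ⨾ MY (E) `HalfMemberSlavedDivergence` §2
  `boxSum_divV_half_fst ∕ snd_of_tableLaw`, table-generic, BY NAME); `divV_snd_halfMember_comb_succ_eq_slaved` — the SECOND slot;
  **`divW_evenMember_comb_succ_eq_slaved`** (`ε = 1`, junction spelling `½ • (T̃′♮ + P T̃′♮)`): NO `R` — «the commutator is EVEN, `R` is ODD»;
  **`divW_oddMember_comb_succ_eq_slaved`** (`ε = −1`, `½ • (T̃′♮ − P T̃′♮)`): NO commutator — PURE RESIDUAL.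
WHAT THIS IS NOT.  The table laws and the parities are DISPLAYED LETTERS (their instances at an2's slot-generic table laws — the commutator EVEN by the OWNER's
`CombEvenTowerAutonomy.trK_SpureCombOf` ⨾ MY `parityEven_comm_of_oddRows`, the `𝒩`-word ODD by `parityOdd_sandwich` on an2's `trK_GcombSh` — are PART 3, next); NOT the window
step ∕ letter rows, NOT the cells `hcell ∕ hcelld` (leaf-03's (C-6)), NOT one row of the S-∕W-slot, NO value, NO rate; asserts NOTHING about Bałaban's tables; the (III′)
campaign is NOT asked (an2 W-4 l.64553) — zero weight; NEVER «G-an2-4 closed» as (CONV-C); NOT D1, NOT `BetaPertH`, NOT continuum, NOT Clay.  2026-08-25.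
-/

noncomputable section

open Finset
open scoped BigOperators
open Literature.MathematicalPhysics.QuantumFieldTheory
open Literature.MathematicalPhysics.QuantumFieldTheory.Balaban1983to89
open Literature.MathematicalPhysics.QuantumFieldTheory.Balaban1983to89.Beta
open ExpKernelCalculus (MKer Decays comp)
open OneStepResolventKernel (Fib)
open SecondOrderResponse (W2SymOfK)
open BalabanStepJetsSucc (mmRead)
open BalabanStepW2 (K3OfK M2Of)
open KernelWard (divV divW)
open AffineAveraging (box toSite)
open Summit.QuantumFields.BalabanUV.Beta.TameKernelCalculus (trK)
open Summit.QuantumFields.BalabanUV.Beta.BorderedHessian (sgnK)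
open Summit.QuantumFields.BalabanUV.Beta.HessKerDressedUnits (unitK unitS)
open Summit.QuantumFields.BalabanUV.Beta.SecondOrderUnits (unitM unitS₂ unitM₂)
open Summit.QuantumFields.BalabanUV.Beta.SpineRooted (T2RecOf e3OfK)
open Summit.QuantumFields.BalabanUV.Beta.SymmetrisedStepJets (SymTables)
open Summit.QuantumFields.BalabanUV.Beta.CombChartStepJets (GcombSh SpureCombOf)
open Summit.QuantumFields.BalabanUV.Beta.GAN24.CombesThomas (sfStep smStep)
open Summit.QuantumFields.BalabanUV.Beta.GAN24.HalfMemberSlavedDivergence (boxSum_divV_half_fst_of_tableLaw boxSum_divV_half_snd_of_tableLaw)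
open Summit.QuantumFields.BalabanUV.Beta.GAN24.CombHalfMemberSlavedDivergence (divW_halfMember_comb_succ_eq divV_snd_halfMember_comb_succ_eq)

namespace Summit.QuantumFields.BalabanUV.Beta.GAN24.CombHalfMemberSlavedDivergenceLaws

variable {d : ℕ} {Lc : ℕ} [NeZero Lc]

/-! ## §2 SLAVE-src for the `ε`-member at the comb data: the composition with the two RAW table laws (letters + parities) -/

section Slave

/-- NOT IN PRINT; OUR BOOKKEEPING.  **SLAVE-src FOR THE `ε`-MEMBER — ITS SOURCE-SLOT DIVERGENCE ONE LEVEL UP IS SLAVED TO LEVEL-`j` FIRST-ORDER DATA, SPLIT BY PARITY**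
(every `ε j y ν y′`; any sym record `tabs` with off-diagonal border `hBff hBmm`).  HYPOTHESES (letters `S X R R″`, Ward constant `cH′ ≠ 0`): the two TABLE LAWS of the RAW member
`T̃′_j` in the literal conclusion shape of an2's slot-generic `WardLocusQuarticTableSlot.tableLaw_T2RecOf_succ ∕ ''` resp. `_zero ∕ ''` at `G := GcombSh Lc` (`hTL`, `hTL″` — verbatim MY (E) PART 2 letters), the
commutator word parity-EVEN (`hC`), the two remainders parity-ODD (`hR`, `hR″`).  CONCLUSION: `divW (y_{j+1}) y ν y′ = divW (½ • (b̃′♮_j + ε • P b̃′♮_j)) y ν y′ +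
(c₄·Lc^{−(d+1)}∕2) • (e3OfK Lc G′♮_j [(sf_j·sm_j)⁻¹ • unitS_j (cH′⁻¹ • (((1+ε)∕2) • (S ∘ X_y − X_y ∘ S) + ((1−ε)∕2) • R y))] ν y′ + the ″ twin)` (PART 1 §1 ⨾ MY (E) §2 `boxSum_divV_half_fst ∕ snd_of_tableLaw` BY NAME).  The twin of MY g72 `divW_halfMember_succ_eq_slaved`. -/
theorem divW_halfMember_comb_succ_eq_slaved (tabs : SymTables d Lc) (cE cVH cΛ cE₂ cB : ℝ) (Tc : Fin 4 → Fin 4 → Fin 4 → Fin 4 → ℝ)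
    (hBff : ∀ κ u κ' u' x z (α β : Fin (d + 1)), tabs.vh₂S κ u κ' u' x z (Sum.inl α) (Sum.inl β) = 0)
    (hBmm : ∀ κ u κ' u' x z (μ ν : Fin (d + 1)), tabs.vh₂S κ u κ' u' x z (Sum.inr μ) (Sum.inr ν) = 0) (j : ℕ)
    {S : Fin (d + 1) → (Fin (d + 1) → ℤ) → MKer (d + 1) (Fib d)} {X : (Fin (d + 1) → ℤ) → MKer (d + 1) (Fib d)}
    {R R'' : (Fin (d + 1) → ℤ) → Fin (d + 1) → (Fin (d + 1) → ℤ) → MKer (d + 1) (Fib d)} {cH' : ℝ} (hcH : cH' ≠ 0)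
    (hTL : ∀ (Y : Fin (d + 1) → ℤ) (κ' : Fin (d + 1)) (u' : Fin (d + 1) → ℤ),
      cH' • ∑ v ∈ box (d + 1) Lc, divV (fun κ u => T2RecOf d Lc (GcombSh Lc) (SpureCombOf tabs cE cVH cΛ) tabs.M cE₂ cB Tc tabs.vh₂S tabs.mixFF j κ u κ' u') ((Lc : ℤ) • Y + toSite v)
        = comp (S κ' u') (X Y) - comp (X Y) (S κ' u') + R Y κ' u')
    (hTL'' : ∀ (Y : Fin (d + 1) → ℤ) (κ : Fin (d + 1)) (u : Fin (d + 1) → ℤ),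
      cH' • ∑ v ∈ box (d + 1) Lc, divV (T2RecOf d Lc (GcombSh Lc) (SpureCombOf tabs cE cVH cΛ) tabs.M cE₂ cB Tc tabs.vh₂S tabs.mixFF j κ u) ((Lc : ℤ) • Y + toSite v)
        = comp (S κ u) (X Y) - comp (X Y) (S κ u) + R'' Y κ u)
    (hC : ∀ (Y : Fin (d + 1) → ℤ) (κ : Fin (d + 1)) (u : Fin (d + 1) → ℤ),
      trK (comp (S κ u) (X Y) - comp (X Y) (S κ u)) = sgnK (comp (S κ u) (X Y) - comp (X Y) (S κ u)))
    (hR : ∀ (Y : Fin (d + 1) → ℤ) (κ : Fin (d + 1)) (u : Fin (d + 1) → ℤ), trK (R Y κ u) = -sgnK (R Y κ u))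
    (hR'' : ∀ (Y : Fin (d + 1) → ℤ) (κ : Fin (d + 1)) (u : Fin (d + 1) → ℤ), trK (R'' Y κ u) = -sgnK (R'' Y κ u))
    (ε : ℝ) (y : Fin (d + 1) → ℤ) (ν : Fin (d + 1)) (y' : Fin (d + 1) → ℤ) :
    divW ((1 / 2 : ℝ) • (unitS₂ (sfStep Lc (j + 1)) (smStep d Lc (j + 1)) (T2RecOf d Lc (GcombSh Lc) (SpureCombOf tabs cE cVH cΛ) tabs.M cE₂ cB Tc tabs.vh₂S tabs.mixFF (j + 1))
          + ε • fun κ u κ' u' => sgnK (trK (unitS₂ (sfStep Lc (j + 1)) (smStep d Lc (j + 1)) (T2RecOf d Lc (GcombSh Lc) (SpureCombOf tabs cE cVH cΛ) tabs.M cE₂ cB Tc tabs.vh₂S tabs.mixFF (j + 1)) κ u κ' u')))) y ν y'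
      = divW ((1 / 2 : ℝ) • ((fun κ u κ' u' => (cE₂ * (Lc : ℝ) ^ (2 * (d + 1))) • mmRead Lc (K3OfK
            (unitK (sfStep Lc j) (smStep d Lc j) (GcombSh (d := d) Lc j)) Lc
            (unitS (sfStep Lc j) (smStep d Lc j) (SpureCombOf tabs cE cVH cΛ j)) (unitM (sfStep Lc j) (smStep d Lc j) (tabs.M j))
            (W2SymOfK (unitK (sfStep Lc j) (smStep d Lc j) (GcombSh (d := d) Lc j)) Lc
              (unitS (sfStep Lc j) (smStep d Lc j) (SpureCombOf tabs cE cVH cΛ j)) (unitM (sfStep Lc j) (smStep d Lc j) (tabs.M j)) 0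
              (unitM₂ (sfStep Lc j) (smStep d Lc j) (M2Of d Lc tabs.mixFF j))) κ u κ' u') + cB • tabs.vh₂S κ u κ' u')
          + ε • fun κ u κ' u' => sgnK (trK ((fun κ u κ' u' => (cE₂ * (Lc : ℝ) ^ (2 * (d + 1))) • mmRead Lc (K3OfK
            (unitK (sfStep Lc j) (smStep d Lc j) (GcombSh (d := d) Lc j)) Lc
            (unitS (sfStep Lc j) (smStep d Lc j) (SpureCombOf tabs cE cVH cΛ j)) (unitM (sfStep Lc j) (smStep d Lc j) (tabs.M j))
            (W2SymOfK (unitK (sfStep Lc j) (smStep d Lc j) (GcombSh (d := d) Lc j)) Lc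
              (unitS (sfStep Lc j) (smStep d Lc j) (SpureCombOf tabs cE cVH cΛ j)) (unitM (sfStep Lc j) (smStep d Lc j) (tabs.M j)) 0
              (unitM₂ (sfStep Lc j) (smStep d Lc j) (M2Of d Lc tabs.mixFF j))) κ u κ' u') + cB • tabs.vh₂S κ u κ' u') κ u κ' u')))) y ν y'
        + (cE₂ * (Lc : ℝ) ^ (2 * (d + 1)) * ((Lc : ℝ) ^ (d + 1))⁻¹ / 2) •
          (e3OfK Lc (unitK (sfStep Lc j) (smStep d Lc j) (GcombSh (d := d) Lc j))
              (fun κ' u' => (sfStep Lc j * smStep d Lc j)⁻¹ • unitS (sfStep Lc j) (smStep d Lc j)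
                (fun κ' u' => cH'⁻¹ • ((((1 : ℝ) + ε) / 2) • (comp (S κ' u') (X y) - comp (X y) (S κ' u')) + (((1 : ℝ) - ε) / 2) • R y κ' u')) κ' u') ν y'
            + e3OfK Lc (unitK (sfStep Lc j) (smStep d Lc j) (GcombSh (d := d) Lc j))
              (fun κ u => (sfStep Lc j * smStep d Lc j)⁻¹ • unitS (sfStep Lc j) (smStep d Lc j)
                (fun κ u => cH'⁻¹ • ((((1 : ℝ) + ε) / 2) • (comp (S κ u) (X y) - comp (X y) (S κ u)) + (((1 : ℝ) - ε) / 2) • R'' y κ u)) κ u) ν y') := by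
  have e₁ : (fun κ' u' => ∑ v ∈ box (d + 1) Lc, divV (fun κ u =>
        ((1 / 2 : ℝ) • (unitS₂ (sfStep Lc j) (smStep d Lc j) (T2RecOf d Lc (GcombSh Lc) (SpureCombOf tabs cE cVH cΛ) tabs.M cE₂ cB Tc tabs.vh₂S tabs.mixFF j)
          + ε • fun κ u κ' u' => sgnK (trK (unitS₂ (sfStep Lc j) (smStep d Lc j) (T2RecOf d Lc (GcombSh Lc) (SpureCombOf tabs cE cVH cΛ) tabs.M cE₂ cB Tc tabs.vh₂S tabs.mixFF j) κ u κ' u')))) κ u κ' u')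
        ((Lc : ℤ) • y + toSite v))
      = fun κ' u' => (sfStep Lc j * smStep d Lc j)⁻¹ • unitS (sfStep Lc j) (smStep d Lc j)
          (fun κ' u' => cH'⁻¹ • ((((1 : ℝ) + ε) / 2) • (comp (S κ' u') (X y) - comp (X y) (S κ' u')) + (((1 : ℝ) - ε) / 2) • R y κ' u')) κ' u' :=
    funext fun κ' => funext fun u' => boxSum_divV_half_fst_of_tableLaw (sfStep Lc j) (smStep d Lc j) hcH hTL hC hR ε y κ' u'
  have e₂ : (fun κ u => ∑ v ∈ box (d + 1) Lc, divV
        (((1 / 2 : ℝ) • (unitS₂ (sfStep Lc j) (smStep d Lc j) (T2RecOf d Lc (GcombSh Lc) (SpureCombOf tabs cE cVH cΛ) tabs.M cE₂ cB Tc tabs.vh₂S tabs.mixFF j)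
          + ε • fun κ u κ' u' => sgnK (trK (unitS₂ (sfStep Lc j) (smStep d Lc j) (T2RecOf d Lc (GcombSh Lc) (SpureCombOf tabs cE cVH cΛ) tabs.M cE₂ cB Tc tabs.vh₂S tabs.mixFF j) κ u κ' u')))) κ u)
        ((Lc : ℤ) • y + toSite v))
      = fun κ u => (sfStep Lc j * smStep d Lc j)⁻¹ • unitS (sfStep Lc j) (smStep d Lc j)
          (fun κ u => cH'⁻¹ • ((((1 : ℝ) + ε) / 2) • (comp (S κ u) (X y) - comp (X y) (S κ u)) + (((1 : ℝ) - ε) / 2) • R'' y κ u)) κ u :=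
    funext fun κ => funext fun u => boxSum_divV_half_snd_of_tableLaw (sfStep Lc j) (smStep d Lc j) hcH hTL'' hC hR'' ε y κ u
  rw [divW_halfMember_comb_succ_eq tabs cE cVH cΛ cE₂ cB Tc hBff hBmm ε j y ν y', e₁, e₂]

/-- NOT IN PRINT; OUR BOOKKEEPING.  **SLAVE-src FOR THE `ε`-MEMBER, SECOND SLOT** (letters `S X R R″ cH′` + parities `hC hR hR″` as above): `divV (y_{j+1} κ u) p =
divV ((½ • (b̃′♮_j + ε • P b̃′♮_j)) κ u) p + (c₄·Lc^{−(d+1)}∕2) • (e3OfK Lc G′♮_j [(sf_j·sm_j)⁻¹ • unitS_j (cH′⁻¹ • (((1+ε)∕2) • (S ∘ X_p − X_p ∘ S) + ((1−ε)∕2) • R p))] κ u +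
the ″ twin)` (PART 1 §1 second-slot T-EQ ⨾ MY (E) §2).  The twin of MY g72 `divV_snd_halfMember_succ_eq_slaved`. -/
theorem divV_snd_halfMember_comb_succ_eq_slaved (tabs : SymTables d Lc) (cE cVH cΛ cE₂ cB : ℝ) (Tc : Fin 4 → Fin 4 → Fin 4 → Fin 4 → ℝ)
    (hBff : ∀ κ u κ' u' x z (α β : Fin (d + 1)), tabs.vh₂S κ u κ' u' x z (Sum.inl α) (Sum.inl β) = 0)
    (hBmm : ∀ κ u κ' u' x z (μ ν : Fin (d + 1)), tabs.vh₂S κ u κ' u' x z (Sum.inr μ) (Sum.inr ν) = 0) (j : ℕ)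
    {S : Fin (d + 1) → (Fin (d + 1) → ℤ) → MKer (d + 1) (Fib d)} {X : (Fin (d + 1) → ℤ) → MKer (d + 1) (Fib d)}
    {R R'' : (Fin (d + 1) → ℤ) → Fin (d + 1) → (Fin (d + 1) → ℤ) → MKer (d + 1) (Fib d)} {cH' : ℝ} (hcH : cH' ≠ 0)
    (hTL : ∀ (Y : Fin (d + 1) → ℤ) (κ' : Fin (d + 1)) (u' : Fin (d + 1) → ℤ),
      cH' • ∑ v ∈ box (d + 1) Lc, divV (fun κ u => T2RecOf d Lc (GcombSh Lc) (SpureCombOf tabs cE cVH cΛ) tabs.M cE₂ cB Tc tabs.vh₂S tabs.mixFF j κ u κ' u') ((Lc : ℤ) • Y + toSite v)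
        = comp (S κ' u') (X Y) - comp (X Y) (S κ' u') + R Y κ' u')
    (hTL'' : ∀ (Y : Fin (d + 1) → ℤ) (κ : Fin (d + 1)) (u : Fin (d + 1) → ℤ),
      cH' • ∑ v ∈ box (d + 1) Lc, divV (T2RecOf d Lc (GcombSh Lc) (SpureCombOf tabs cE cVH cΛ) tabs.M cE₂ cB Tc tabs.vh₂S tabs.mixFF j κ u) ((Lc : ℤ) • Y + toSite v)
        = comp (S κ u) (X Y) - comp (X Y) (S κ u) + R'' Y κ u)
    (hC : ∀ (Y : Fin (d + 1) → ℤ) (κ : Fin (d + 1)) (u : Fin (d + 1) → ℤ),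
      trK (comp (S κ u) (X Y) - comp (X Y) (S κ u)) = sgnK (comp (S κ u) (X Y) - comp (X Y) (S κ u)))
    (hR : ∀ (Y : Fin (d + 1) → ℤ) (κ : Fin (d + 1)) (u : Fin (d + 1) → ℤ), trK (R Y κ u) = -sgnK (R Y κ u))
    (hR'' : ∀ (Y : Fin (d + 1) → ℤ) (κ : Fin (d + 1)) (u : Fin (d + 1) → ℤ), trK (R'' Y κ u) = -sgnK (R'' Y κ u))
    (ε : ℝ) (p : Fin (d + 1) → ℤ) (κ : Fin (d + 1)) (u : Fin (d + 1) → ℤ) :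
    divV (((1 / 2 : ℝ) • (unitS₂ (sfStep Lc (j + 1)) (smStep d Lc (j + 1)) (T2RecOf d Lc (GcombSh Lc) (SpureCombOf tabs cE cVH cΛ) tabs.M cE₂ cB Tc tabs.vh₂S tabs.mixFF (j + 1))
          + ε • fun κ u κ' u' => sgnK (trK (unitS₂ (sfStep Lc (j + 1)) (smStep d Lc (j + 1)) (T2RecOf d Lc (GcombSh Lc) (SpureCombOf tabs cE cVH cΛ) tabs.M cE₂ cB Tc tabs.vh₂S tabs.mixFF (j + 1)) κ u κ' u')))) κ u) p
      = divV (((1 / 2 : ℝ) • ((fun κ u κ' u' => (cE₂ * (Lc : ℝ) ^ (2 * (d + 1))) • mmRead Lc (K3OfK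
            (unitK (sfStep Lc j) (smStep d Lc j) (GcombSh (d := d) Lc j)) Lc
            (unitS (sfStep Lc j) (smStep d Lc j) (SpureCombOf tabs cE cVH cΛ j)) (unitM (sfStep Lc j) (smStep d Lc j) (tabs.M j))
            (W2SymOfK (unitK (sfStep Lc j) (smStep d Lc j) (GcombSh (d := d) Lc j)) Lc
              (unitS (sfStep Lc j) (smStep d Lc j) (SpureCombOf tabs cE cVH cΛ j)) (unitM (sfStep Lc j) (smStep d Lc j) (tabs.M j)) 0
              (unitM₂ (sfStep Lc j) (smStep d Lc j) (M2Of d Lc tabs.mixFF j))) κ u κ' u') + cB • tabs.vh₂S κ u κ' u')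
          + ε • fun κ u κ' u' => sgnK (trK ((fun κ u κ' u' => (cE₂ * (Lc : ℝ) ^ (2 * (d + 1))) • mmRead Lc (K3OfK
            (unitK (sfStep Lc j) (smStep d Lc j) (GcombSh (d := d) Lc j)) Lc
            (unitS (sfStep Lc j) (smStep d Lc j) (SpureCombOf tabs cE cVH cΛ j)) (unitM (sfStep Lc j) (smStep d Lc j) (tabs.M j))
            (W2SymOfK (unitK (sfStep Lc j) (smStep d Lc j) (GcombSh (d := d) Lc j)) Lc
              (unitS (sfStep Lc j) (smStep d Lc j) (SpureCombOf tabs cE cVH cΛ j)) (unitM (sfStep Lc j) (smStep d Lc j) (tabs.M j)) 0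
              (unitM₂ (sfStep Lc j) (smStep d Lc j) (M2Of d Lc tabs.mixFF j))) κ u κ' u') + cB • tabs.vh₂S κ u κ' u') κ u κ' u')))) κ u) p
        + (cE₂ * (Lc : ℝ) ^ (2 * (d + 1)) * ((Lc : ℝ) ^ (d + 1))⁻¹ / 2) •
          (e3OfK Lc (unitK (sfStep Lc j) (smStep d Lc j) (GcombSh (d := d) Lc j))
              (fun κ' u' => (sfStep Lc j * smStep d Lc j)⁻¹ • unitS (sfStep Lc j) (smStep d Lc j)
                (fun κ' u' => cH'⁻¹ • ((((1 : ℝ) + ε) / 2) • (comp (S κ' u') (X p) - comp (X p) (S κ' u')) + (((1 : ℝ) - ε) / 2) • R p κ' u')) κ' u') κ u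
            + e3OfK Lc (unitK (sfStep Lc j) (smStep d Lc j) (GcombSh (d := d) Lc j))
              (fun κ u => (sfStep Lc j * smStep d Lc j)⁻¹ • unitS (sfStep Lc j) (smStep d Lc j)
                (fun κ u => cH'⁻¹ • ((((1 : ℝ) + ε) / 2) • (comp (S κ u) (X p) - comp (X p) (S κ u)) + (((1 : ℝ) - ε) / 2) • R'' p κ u)) κ u) κ u) := by
  have e₁ : (fun κ' u' => ∑ v ∈ box (d + 1) Lc, divV (fun κ₁ u₁ =>
        ((1 / 2 : ℝ) • (unitS₂ (sfStep Lc j) (smStep d Lc j) (T2RecOf d Lc (GcombSh Lc) (SpureCombOf tabs cE cVH cΛ) tabs.M cE₂ cB Tc tabs.vh₂S tabs.mixFF j)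
          + ε • fun κ u κ' u' => sgnK (trK (unitS₂ (sfStep Lc j) (smStep d Lc j) (T2RecOf d Lc (GcombSh Lc) (SpureCombOf tabs cE cVH cΛ) tabs.M cE₂ cB Tc tabs.vh₂S tabs.mixFF j) κ u κ' u')))) κ₁ u₁ κ' u')
        ((Lc : ℤ) • p + toSite v))
      = fun κ' u' => (sfStep Lc j * smStep d Lc j)⁻¹ • unitS (sfStep Lc j) (smStep d Lc j)
          (fun κ' u' => cH'⁻¹ • ((((1 : ℝ) + ε) / 2) • (comp (S κ' u') (X p) - comp (X p) (S κ' u')) + (((1 : ℝ) - ε) / 2) • R p κ' u')) κ' u' :=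
    funext fun κ' => funext fun u' => boxSum_divV_half_fst_of_tableLaw (sfStep Lc j) (smStep d Lc j) hcH hTL hC hR ε p κ' u'
  have e₂ : (fun κ₁ u₁ => ∑ v ∈ box (d + 1) Lc, divV
        (((1 / 2 : ℝ) • (unitS₂ (sfStep Lc j) (smStep d Lc j) (T2RecOf d Lc (GcombSh Lc) (SpureCombOf tabs cE cVH cΛ) tabs.M cE₂ cB Tc tabs.vh₂S tabs.mixFF j)
          + ε • fun κ u κ' u' => sgnK (trK (unitS₂ (sfStep Lc j) (smStep d Lc j) (T2RecOf d Lc (GcombSh Lc) (SpureCombOf tabs cE cVH cΛ) tabs.M cE₂ cB Tc tabs.vh₂S tabs.mixFF j) κ u κ' u')))) κ₁ u₁)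
        ((Lc : ℤ) • p + toSite v))
      = fun κ u => (sfStep Lc j * smStep d Lc j)⁻¹ • unitS (sfStep Lc j) (smStep d Lc j)
          (fun κ u => cH'⁻¹ • ((((1 : ℝ) + ε) / 2) • (comp (S κ u) (X p) - comp (X p) (S κ u)) + (((1 : ℝ) - ε) / 2) • R'' p κ u)) κ u :=
    funext fun κ => funext fun u => boxSum_divV_half_snd_of_tableLaw (sfStep Lc j) (smStep d Lc j) hcH hTL'' hC hR'' ε p κ u
  rw [divV_snd_halfMember_comb_succ_eq tabs cE cVH cΛ cE₂ cB Tc hBff hBmm ε j p κ u, e₁, e₂]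

/-- NOT IN PRINT; OUR BOOKKEEPING.  **(α-END-b1) «THE EVEN MEMBER's SLAVED DIVERGENCE»** (the OWNER gan24-p1 g33's displayed sentence, W9 l.49725): for the EVEN member
`T̃′♮^{ev}_j := ½ • (T̃′♮_j + P T̃′♮_j)` (the junction's spelling) under the two raw table laws and the parities `hC hR hR″`,
`divW (T̃′♮^{ev}_{j+1}) y ν y′ = divW (b̃′♮^{ev}_j) y ν y′ + (c₄·(Lc^{d+1})⁻¹∕2) • (e3OfK Lc G′♮_j [(sf_j·sm_j)⁻¹ • unitS_j (κ′u′ ↦ cH′⁻¹ • (S κ′u′ ∘ X_y − X_y ∘ S κ′u′))] ν y′ + the ″ twin)`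
— **NO `R`**: the commutator is EVEN, `R` is ODD (§2 at `ε = 1`).  The twin of MY g72 `divW_evenMember_succ_eq_slaved` at the comb-chart data. -/
theorem divW_evenMember_comb_succ_eq_slaved (tabs : SymTables d Lc) (cE cVH cΛ cE₂ cB : ℝ) (Tc : Fin 4 → Fin 4 → Fin 4 → Fin 4 → ℝ)
    (hBff : ∀ κ u κ' u' x z (α β : Fin (d + 1)), tabs.vh₂S κ u κ' u' x z (Sum.inl α) (Sum.inl β) = 0)
    (hBmm : ∀ κ u κ' u' x z (μ ν : Fin (d + 1)), tabs.vh₂S κ u κ' u' x z (Sum.inr μ) (Sum.inr ν) = 0) (j : ℕ)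
    {S : Fin (d + 1) → (Fin (d + 1) → ℤ) → MKer (d + 1) (Fib d)} {X : (Fin (d + 1) → ℤ) → MKer (d + 1) (Fib d)}
    {R R'' : (Fin (d + 1) → ℤ) → Fin (d + 1) → (Fin (d + 1) → ℤ) → MKer (d + 1) (Fib d)} {cH' : ℝ} (hcH : cH' ≠ 0)
    (hTL : ∀ (Y : Fin (d + 1) → ℤ) (κ' : Fin (d + 1)) (u' : Fin (d + 1) → ℤ),
      cH' • ∑ v ∈ box (d + 1) Lc, divV (fun κ u => T2RecOf d Lc (GcombSh Lc) (SpureCombOf tabs cE cVH cΛ) tabs.M cE₂ cB Tc tabs.vh₂S tabs.mixFF j κ u κ' u') ((Lc : ℤ) • Y + toSite v)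
        = comp (S κ' u') (X Y) - comp (X Y) (S κ' u') + R Y κ' u')
    (hTL'' : ∀ (Y : Fin (d + 1) → ℤ) (κ : Fin (d + 1)) (u : Fin (d + 1) → ℤ),
      cH' • ∑ v ∈ box (d + 1) Lc, divV (T2RecOf d Lc (GcombSh Lc) (SpureCombOf tabs cE cVH cΛ) tabs.M cE₂ cB Tc tabs.vh₂S tabs.mixFF j κ u) ((Lc : ℤ) • Y + toSite v)
        = comp (S κ u) (X Y) - comp (X Y) (S κ u) + R'' Y κ u)
    (hC : ∀ (Y : Fin (d + 1) → ℤ) (κ : Fin (d + 1)) (u : Fin (d + 1) → ℤ),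
      trK (comp (S κ u) (X Y) - comp (X Y) (S κ u)) = sgnK (comp (S κ u) (X Y) - comp (X Y) (S κ u)))
    (hR : ∀ (Y : Fin (d + 1) → ℤ) (κ : Fin (d + 1)) (u : Fin (d + 1) → ℤ), trK (R Y κ u) = -sgnK (R Y κ u))
    (hR'' : ∀ (Y : Fin (d + 1) → ℤ) (κ : Fin (d + 1)) (u : Fin (d + 1) → ℤ), trK (R'' Y κ u) = -sgnK (R'' Y κ u))
    (y : Fin (d + 1) → ℤ) (ν : Fin (d + 1)) (y' : Fin (d + 1) → ℤ) :
    divW ((1 / 2 : ℝ) • (unitS₂ (sfStep Lc (j + 1)) (smStep d Lc (j + 1)) (T2RecOf d Lc (GcombSh Lc) (SpureCombOf tabs cE cVH cΛ) tabs.M cE₂ cB Tc tabs.vh₂S tabs.mixFF (j + 1))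
          + fun κ u κ' u' => sgnK (trK (unitS₂ (sfStep Lc (j + 1)) (smStep d Lc (j + 1)) (T2RecOf d Lc (GcombSh Lc) (SpureCombOf tabs cE cVH cΛ) tabs.M cE₂ cB Tc tabs.vh₂S tabs.mixFF (j + 1)) κ u κ' u')))) y ν y'
      = divW ((1 / 2 : ℝ) • ((fun κ u κ' u' => (cE₂ * (Lc : ℝ) ^ (2 * (d + 1))) • mmRead Lc (K3OfK
            (unitK (sfStep Lc j) (smStep d Lc j) (GcombSh (d := d) Lc j)) Lc
            (unitS (sfStep Lc j) (smStep d Lc j) (SpureCombOf tabs cE cVH cΛ j)) (unitM (sfStep Lc j) (smStep d Lc j) (tabs.M j))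
            (W2SymOfK (unitK (sfStep Lc j) (smStep d Lc j) (GcombSh (d := d) Lc j)) Lc
              (unitS (sfStep Lc j) (smStep d Lc j) (SpureCombOf tabs cE cVH cΛ j)) (unitM (sfStep Lc j) (smStep d Lc j) (tabs.M j)) 0
              (unitM₂ (sfStep Lc j) (smStep d Lc j) (M2Of d Lc tabs.mixFF j))) κ u κ' u') + cB • tabs.vh₂S κ u κ' u')
          + fun κ u κ' u' => sgnK (trK ((fun κ u κ' u' => (cE₂ * (Lc : ℝ) ^ (2 * (d + 1))) • mmRead Lc (K3OfK
            (unitK (sfStep Lc j) (smStep d Lc j) (GcombSh (d := d) Lc j)) Lc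
            (unitS (sfStep Lc j) (smStep d Lc j) (SpureCombOf tabs cE cVH cΛ j)) (unitM (sfStep Lc j) (smStep d Lc j) (tabs.M j))
            (W2SymOfK (unitK (sfStep Lc j) (smStep d Lc j) (GcombSh (d := d) Lc j)) Lc
              (unitS (sfStep Lc j) (smStep d Lc j) (SpureCombOf tabs cE cVH cΛ j)) (unitM (sfStep Lc j) (smStep d Lc j) (tabs.M j)) 0
              (unitM₂ (sfStep Lc j) (smStep d Lc j) (M2Of d Lc tabs.mixFF j))) κ u κ' u') + cB • tabs.vh₂S κ u κ' u') κ u κ' u')))) y ν y'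
        + (cE₂ * (Lc : ℝ) ^ (2 * (d + 1)) * ((Lc : ℝ) ^ (d + 1))⁻¹ / 2) •
          (e3OfK Lc (unitK (sfStep Lc j) (smStep d Lc j) (GcombSh (d := d) Lc j))
              (fun κ' u' => (sfStep Lc j * smStep d Lc j)⁻¹ • unitS (sfStep Lc j) (smStep d Lc j)
                (fun κ' u' => cH'⁻¹ • (comp (S κ' u') (X y) - comp (X y) (S κ' u'))) κ' u') ν y'
            + e3OfK Lc (unitK (sfStep Lc j) (smStep d Lc j) (GcombSh (d := d) Lc j))
              (fun κ u => (sfStep Lc j * smStep d Lc j)⁻¹ • unitS (sfStep Lc j) (smStep d Lc j)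
                (fun κ u => cH'⁻¹ • (comp (S κ u) (X y) - comp (X y) (S κ u))) κ u) ν y') := by
  have h := divW_halfMember_comb_succ_eq_slaved tabs cE cVH cΛ cE₂ cB Tc hBff hBmm j hcH hTL hTL'' hC hR hR'' 1 y ν y'
  have h1 : ((1 : ℝ) + 1) / 2 = 1 := by norm_num
  have h0 : ((1 : ℝ) - 1) / 2 = 0 := by norm_num
  rw [h1, h0] at h
  simp only [one_smul, zero_smul, add_zero] at h
  exact h

/-- NOT IN PRINT; OUR BOOKKEEPING.  **THE ODD MEMBER's SLAVED DIVERGENCE IS PURE RESIDUAL**: for `T̃′♮^{od}_j := ½ • (T̃′♮_j − P T̃′♮_j)` under the same letters,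
`divW (T̃′♮^{od}_{j+1}) y ν y′ = divW (b̃′♮^{od}_j) y ν y′ + (c₄·(Lc^{d+1})⁻¹∕2) • (e3OfK Lc G′♮_j [(sf_j·sm_j)⁻¹ • unitS_j (κ′u′ ↦ cH′⁻¹ • R y κ′u′)] ν y′ + the ″ twin with `R″`)`
— **NO COMMUTATOR** (§2 at `ε = −1`); the half the D1 consumer is blind to (the OWNER's `CombTowerEndOfSlots` §5 ∕ `WSlotParityBlind`).  The twin of MY g72 `divW_oddMember_succ_eq_slaved`. -/
theorem divW_oddMember_comb_succ_eq_slaved (tabs : SymTables d Lc) (cE cVH cΛ cE₂ cB : ℝ) (Tc : Fin 4 → Fin 4 → Fin 4 → Fin 4 → ℝ)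
    (hBff : ∀ κ u κ' u' x z (α β : Fin (d + 1)), tabs.vh₂S κ u κ' u' x z (Sum.inl α) (Sum.inl β) = 0)
    (hBmm : ∀ κ u κ' u' x z (μ ν : Fin (d + 1)), tabs.vh₂S κ u κ' u' x z (Sum.inr μ) (Sum.inr ν) = 0) (j : ℕ)
    {S : Fin (d + 1) → (Fin (d + 1) → ℤ) → MKer (d + 1) (Fib d)} {X : (Fin (d + 1) → ℤ) → MKer (d + 1) (Fib d)}
    {R R'' : (Fin (d + 1) → ℤ) → Fin (d + 1) → (Fin (d + 1) → ℤ) → MKer (d + 1) (Fib d)} {cH' : ℝ} (hcH : cH' ≠ 0)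
    (hTL : ∀ (Y : Fin (d + 1) → ℤ) (κ' : Fin (d + 1)) (u' : Fin (d + 1) → ℤ),
      cH' • ∑ v ∈ box (d + 1) Lc, divV (fun κ u => T2RecOf d Lc (GcombSh Lc) (SpureCombOf tabs cE cVH cΛ) tabs.M cE₂ cB Tc tabs.vh₂S tabs.mixFF j κ u κ' u') ((Lc : ℤ) • Y + toSite v)
        = comp (S κ' u') (X Y) - comp (X Y) (S κ' u') + R Y κ' u')
    (hTL'' : ∀ (Y : Fin (d + 1) → ℤ) (κ : Fin (d + 1)) (u : Fin (d + 1) → ℤ),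
      cH' • ∑ v ∈ box (d + 1) Lc, divV (T2RecOf d Lc (GcombSh Lc) (SpureCombOf tabs cE cVH cΛ) tabs.M cE₂ cB Tc tabs.vh₂S tabs.mixFF j κ u) ((Lc : ℤ) • Y + toSite v)
        = comp (S κ u) (X Y) - comp (X Y) (S κ u) + R'' Y κ u)
    (hC : ∀ (Y : Fin (d + 1) → ℤ) (κ : Fin (d + 1)) (u : Fin (d + 1) → ℤ),
      trK (comp (S κ u) (X Y) - comp (X Y) (S κ u)) = sgnK (comp (S κ u) (X Y) - comp (X Y) (S κ u)))
    (hR : ∀ (Y : Fin (d + 1) → ℤ) (κ : Fin (d + 1)) (u : Fin (d + 1) → ℤ), trK (R Y κ u) = -sgnK (R Y κ u))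
    (hR'' : ∀ (Y : Fin (d + 1) → ℤ) (κ : Fin (d + 1)) (u : Fin (d + 1) → ℤ), trK (R'' Y κ u) = -sgnK (R'' Y κ u))
    (y : Fin (d + 1) → ℤ) (ν : Fin (d + 1)) (y' : Fin (d + 1) → ℤ) :
    divW ((1 / 2 : ℝ) • (unitS₂ (sfStep Lc (j + 1)) (smStep d Lc (j + 1)) (T2RecOf d Lc (GcombSh Lc) (SpureCombOf tabs cE cVH cΛ) tabs.M cE₂ cB Tc tabs.vh₂S tabs.mixFF (j + 1))
          - fun κ u κ' u' => sgnK (trK (unitS₂ (sfStep Lc (j + 1)) (smStep d Lc (j + 1)) (T2RecOf d Lc (GcombSh Lc) (SpureCombOf tabs cE cVH cΛ) tabs.M cE₂ cB Tc tabs.vh₂S tabs.mixFF (j + 1)) κ u κ' u')))) y ν y'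
      = divW ((1 / 2 : ℝ) • ((fun κ u κ' u' => (cE₂ * (Lc : ℝ) ^ (2 * (d + 1))) • mmRead Lc (K3OfK
            (unitK (sfStep Lc j) (smStep d Lc j) (GcombSh (d := d) Lc j)) Lc
            (unitS (sfStep Lc j) (smStep d Lc j) (SpureCombOf tabs cE cVH cΛ j)) (unitM (sfStep Lc j) (smStep d Lc j) (tabs.M j))
            (W2SymOfK (unitK (sfStep Lc j) (smStep d Lc j) (GcombSh (d := d) Lc j)) Lc
              (unitS (sfStep Lc j) (smStep d Lc j) (SpureCombOf tabs cE cVH cΛ j)) (unitM (sfStep Lc j) (smStep d Lc j) (tabs.M j)) 0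
              (unitM₂ (sfStep Lc j) (smStep d Lc j) (M2Of d Lc tabs.mixFF j))) κ u κ' u') + cB • tabs.vh₂S κ u κ' u')
          - fun κ u κ' u' => sgnK (trK ((fun κ u κ' u' => (cE₂ * (Lc : ℝ) ^ (2 * (d + 1))) • mmRead Lc (K3OfK
            (unitK (sfStep Lc j) (smStep d Lc j) (GcombSh (d := d) Lc j)) Lc
            (unitS (sfStep Lc j) (smStep d Lc j) (SpureCombOf tabs cE cVH cΛ j)) (unitM (sfStep Lc j) (smStep d Lc j) (tabs.M j))
            (W2SymOfK (unitK (sfStep Lc j) (smStep d Lc j) (GcombSh (d := d) Lc j)) Lc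
              (unitS (sfStep Lc j) (smStep d Lc j) (SpureCombOf tabs cE cVH cΛ j)) (unitM (sfStep Lc j) (smStep d Lc j) (tabs.M j)) 0
              (unitM₂ (sfStep Lc j) (smStep d Lc j) (M2Of d Lc tabs.mixFF j))) κ u κ' u') + cB • tabs.vh₂S κ u κ' u') κ u κ' u')))) y ν y'
        + (cE₂ * (Lc : ℝ) ^ (2 * (d + 1)) * ((Lc : ℝ) ^ (d + 1))⁻¹ / 2) •
          (e3OfK Lc (unitK (sfStep Lc j) (smStep d Lc j) (GcombSh (d := d) Lc j))
              (fun κ' u' => (sfStep Lc j * smStep d Lc j)⁻¹ • unitS (sfStep Lc j) (smStep d Lc j)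
                (fun κ' u' => cH'⁻¹ • R y κ' u') κ' u') ν y'
            + e3OfK Lc (unitK (sfStep Lc j) (smStep d Lc j) (GcombSh (d := d) Lc j))
              (fun κ u => (sfStep Lc j * smStep d Lc j)⁻¹ • unitS (sfStep Lc j) (smStep d Lc j)
                (fun κ u => cH'⁻¹ • R'' y κ u) κ u) ν y') := by
  have h := divW_halfMember_comb_succ_eq_slaved tabs cE cVH cΛ cE₂ cB Tc hBff hBmm j hcH hTL hTL'' hC hR hR'' (-1) y ν y'
  have h1 : ((1 : ℝ) + -1) / 2 = 0 := by norm_num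
  have h0 : ((1 : ℝ) - -1) / 2 = 1 := by norm_num
  rw [h1, h0] at h
  simp only [one_smul, zero_smul, zero_add, neg_one_smul] at h
  simp only [← sub_eq_add_neg] at h
  exact h

end Slave

end Summit.QuantumFields.BalabanUV.Beta.GAN24.CombHalfMemberSlavedDivergenceLaws

end
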